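import Summits.AtomisticToContinuum.Crystallization.Theorems.GappedShellCensusCleanLimitsHaveWindowsCleanChartTSteps1
import Summits.AtomisticToContinuum.Crystallization.Theorems.GappedShellCensusCleanLimitsHaveWindowsCleanChartTSteps2
import Summits.AtomisticToContinuum.Crystallization.Theorems.GappedShellCensusCleanLimitsHaveWindowsCleanChartTSteps3
import Summits.AtomisticToContinuum.Crystallization.Theorems.GappedShellCensusCleanLimitsHaveWindowsCleanChartTSteps5
import Summits.AtomisticToContinuum.Crystallization.Theorems.GappedShellCensusCleanLimitsHaveWindowsCleanChartTSteps7
import Summits.AtomisticToContinuum.Crystallization.Theorems.GappedShellCensusCleanLimitsHaveWindowsCleanChartTAttach1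
import Summits.AtomisticToContinuum.Crystallization.Theorems.GappedShellCensusCleanLimitsHaveWindowsCleanChartTComm1
import Summits.AtomisticToContinuum.Crystallization.Theorems.GappedShellCensusCleanLimitsHaveWindowsCleanChartTComm2
import Summits.AtomisticToContinuum.Crystallization.Theorems.PalmUnimodularRigidityShellsToBarlowChartTransportLayerZero

/-!
# `CleanLimitsHaveWindows` (stmt-AtomisticToContinuum-15932), line `Sketch` — stub K1 (`stub_cleanChart`):
# the transport development re-run on CLEAN charts — copy of `PalmUnimodularRigidityShellsToBarlowChartTransportLayerZero`

This file is a mechanical copy of `Theorems/PalmUnimodularRigidityShellsToBarlowChartTransportLayerZero.lean` (crux `ShellsToBarlowChart`,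
route `PalmUnimodularRigidity`; original title: Line `develop-the-model-growth-descent` (crux `ShellsToBarlowChart`, stmt-AtomisticToContinuum-9227): in-layer commutation `I ∘ J = J ∘ I` at parity `+1`)
in which the chart hypothesis `hch : ∀ z ∈ S, IsZChart S z (ac z) (Pc z) (Ac z) (nb z)` (integer charts with
`1 %` closeness) is replaced by the CLEAN-CHART hypothesis: at every site a labelling of the bonded neighbours
by `fcc3Int`/`hcpInt`, bijective, with bonds among neighbours = label pairs at squared distance `18`, together
with the TRANSFER property across every bond (proved for clean sets at matching radius `1/5` in
`…CleanChartTransfer`).  The original development uses its metric hypothesis only through the transfer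
lemma, so all proofs go through verbatim; declarations live in the sub-namespace `….Clean` and shadow the
originals, the `hch`-free lemmas of the original file are reused, not restated.  All `[folklore]`.
-/

noncomputable section

namespace Summit.AtomisticToContinuum.Crystallization.Theorems.PalmUnimodularRigidityShellsToBarlowChart.Clean

open Literature.Geometry.DiscreteGeometry Literature.MathematicalPhysics.StatisticalMechanics
open Summit.AtomisticToContinuum.Crystallization.Theorems.ShellsToBarlowChartNegative

variable {S : Set (EuclideanSpace ℝ (Fin 3))} {Pc : (EuclideanSpace ℝ (Fin 3)) → Finset (Fin 3 → ℤ)}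
  {nb : (EuclideanSpace ℝ (Fin 3)) → (Fin 3 → ℤ) → (EuclideanSpace ℝ (Fin 3))}

/-- **In-layer commutation `I (J g) = J (I g)` at the base layer.**  For a valid frame `g` of parity
`+1` in the base regime (all sites FCC, or `x` HCP) whose four in-layer transports are valid, the
two ways around the rhombus `x, Ix, Jx, IJx` give the same frame at `IJx`: the points agree by the
hexagon identity at `Jx`, the directions by the hexagon identities at `IJx`, and the caps because
the two transported upper references are the `t₁`- and `t₂`-neighbours of the frame `V g`, hence
bonded, hence in one cap. [folklore] -/
theorem Istep_Jstep_comm (hch : ((∀ z ∈ S, (Pc z = fcc3Int ∨ Pc z = hcpInt) ∧ Set.BijOn (nb z) (↑(Pc z) : Set (Fin 3 → ℤ)) {y | y ∈ S ∧ (0 < dist z y ∧ dist z y ≤ 28 / 25)} ∧ (∀ t ∈ Pc z, ∀ t' ∈ Pc z, ((0 < dist (nb z t) (nb z t') ∧ dist (nb z t) (nb z t') ≤ 28 / 25) ↔ sqNormInt (t - t') = 18))) ∧ (∀ x ∈ S, ∀ y ∈ S, (0 < dist x y ∧ dist x y ≤ 28 / 25) → ∀ t ∈ Pc x, ∀ t'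 ∈ Pc x, ∀ u ∈ Pc y, ∀ u' ∈ Pc y, nb y u = nb x t → nb y u' = nb x t' → sqNormInt (u - u') = sqNormInt (t - t')))) {x : (EuclideanSpace ℝ (Fin 3))} (hx : x ∈ S) {t₁ t₂ : Fin 3 → ℤ} {U : Finset (Fin 3 → ℤ)} (hU : IsFrame (Pc x) t₁ t₂ U) (hpar : frameParity t₁ t₂ U = 1) (hA : (∀ z ∈ S, Pc z = fcc3Int) ∨ Pc x = hcpInt) (hI : IsFrame (Pc (nb x t₁)) (Istep Pc nb ⟨x, t₁, t₂, U⟩).t₁ (Istep Pc nb ⟨x, t₁, t₂, U⟩).t₂ (Istep Pc nb ⟨x, t₁, t₂, U⟩).U) (hJ : IsFrame (Pc (nb x t₂)) (Jstep Pc nb ⟨x, t₁, t₂, U⟩).t₁ (Jstep Pc nb ⟨x, t₁, t₂, U⟩).t₂ (Jstep Pc nb ⟨x, t₁, t₂, U⟩).U) (hIi : IsFrame (Pc (nb x (-t₁))) (IinvStep Pc nb ⟨x, t₁, t₂, U⟩).t₁ (IinvStep Pc nb ⟨x, t₁, t₂, U⟩).t₂ (IinvStep Pc nb ⟨x, t₁,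 t₂, U⟩).U) (hJi : IsFrame (Pc (nb x (-t₂))) (JinvStep Pc nb ⟨x, t₁, t₂, U⟩).t₁ (JinvStep Pc nb ⟨x, t₁, t₂, U⟩).t₂ (JinvStep Pc nb ⟨x, t₁, t₂, U⟩).U) : Istep Pc nb (Jstep Pc nb ⟨x, t₁, t₂, U⟩) = Jstep Pc nb (Istep Pc nb ⟨x, t₁, t₂, U⟩) := by
  have hPx := pattern_cases hch hx
  obtain ⟨h12, hhex, hUP, -, -⟩ := id hU
  have ht₁ : t₁ ∈ Pc x := hhex (mem_hexLabels_iff.2 (Or.inl rfl))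
  have ht₂ : t₂ ∈ Pc x := hhex (mem_hexLabels_iff.2 (Or.inr (Or.inl rfl)))
  -- regime at `x`
  have hregI : Pc (nb x t₁) = fcc3Int ∨ Pc x = hcpInt ∨
      (-zlab Pc nb (nb x t₁) x ∈ Pc (nb x t₁) ∧ -zlab Pc nb (nb x t₁) (nb x t₂) ∈ Pc (nb x t₁)) := by
    rcases hA with hF | hH
    · exact Or.inl (hF _ (nb_mem hch hx ht₁).1)
    · exact Or.inr (Or.inl hH)
  have hregJ : Pc (nb x t₂) = fcc3Int ∨ Pc x = hcpInt ∨
      (-zlab Pc nb (nb x t₂) x ∈ Pc (nb x t₂) ∧ -zlab Pc nb (nb x t₂) (nb x t₁) ∈ Pc (nb x t₂)) := by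
    rcases hA with hF | hH
    · exact Or.inl (hF _ (nb_mem hch hx ht₂).1)
    · exact Or.inr (Or.inl hH)
  obtain ⟨hy₁S, hbxy₁, hw₁P, hw₁x, hv₁P, hv₁nb, hnw₁, hnv₁, hDwv₁, -, htype₁, hframe₁, hpar₁, -⟩ :=
    Istep_spec hch hx hU hregI
  obtain ⟨hy₂S, hbxy₂, hw₂P, hw₂x, hv₂P, hv₂nb, hnw₂, hnv₂, hDwv₂, -, htype₂, hframe₂, hpar₂, -⟩ :=
    Jstep_spec hch hx hU hregJ
  obtain ⟨hcU, huS, hbu, hξP, hξx, hframeV, -, -⟩ := Vstep_spec hch hx hU hI hJ hIi hJi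
  obtain ⟨hptI, -, -⟩ := Vstep_Istep_pt hch hx hU hI hJ hIi hJi
  obtain ⟨hptJ, -, -⟩ := Vstep_Jstep_pt hch hx hU hI hJ hIi hJi
  have hPy₁ := pattern_cases hch hy₁S
  have hPy₂ := pattern_cases hch hy₂S
  have hPu := pattern_cases hch huS
  -- frames `I g = ⟨y₁, a₁, b₁, U₁⟩`, `J g = ⟨y₂, a₂, b₂, U₂⟩`, `V g = ⟨u, τ₁, τ₂, UV⟩`
  set a₁ := (Istep Pc nb ⟨x, t₁, t₂, U⟩).t₁ with ha₁
  set b₁ := (Istep Pc nb ⟨x, t₁, t₂, U⟩).t₂ with hb₁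
  set U₁ := (Istep Pc nb ⟨x, t₁, t₂, U⟩).U with hU₁_def
  have hIeq : Istep Pc nb ⟨x, t₁, t₂, U⟩ = ⟨nb x t₁, a₁, b₁, U₁⟩ := rfl
  set a₂ := (Jstep Pc nb ⟨x, t₁, t₂, U⟩).t₁ with ha₂
  set b₂ := (Jstep Pc nb ⟨x, t₁, t₂, U⟩).t₂ with hb₂
  set U₂ := (Jstep Pc nb ⟨x, t₁, t₂, U⟩).U with hU₂_def
  have hJeq : Jstep Pc nb ⟨x, t₁, t₂, U⟩ = ⟨nb x t₂, a₂, b₂, U₂⟩ := rfl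
  set c := apexOf t₁ t₂ U with hc_def
  have hVpt : (Vstep Pc nb ⟨x, t₁, t₂, U⟩).pt = nb x c := rfl
  rw [hIeq, hVpt] at hptI
  rw [hJeq, hVpt] at hptJ
  set u := nb x c with hu_def
  set τ₁ := (Vstep Pc nb ⟨x, t₁, t₂, U⟩).t₁ with hτ₁_def
  set τ₂ := (Vstep Pc nb ⟨x, t₁, t₂, U⟩).t₂ with hτ₂_def
  have hτ₁P : τ₁ ∈ Pc u := hframeV.2.1 (mem_hexLabels_iff.2 (Or.inl rfl))
  have hτ₂P : τ₂ ∈ Pc u := hframeV.2.1 (mem_hexLabels_iff.2 (Or.inr (Or.inl rfl)))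
  rw [hIeq, hJeq]
  obtain ⟨h12₁, hhex₁, hUP₁, -, -⟩ := id hframe₁
  obtain ⟨h12₂, hhex₂, hUP₂, -, -⟩ := id hframe₂
  have ha₁P : a₁ ∈ Pc (nb x t₁) := hhex₁ (mem_hexLabels_iff.2 (Or.inl rfl))
  have hb₁P : b₁ ∈ Pc (nb x t₁) := hhex₁ (mem_hexLabels_iff.2 (Or.inr (Or.inl rfl)))
  have ha₂P : a₂ ∈ Pc (nb x t₂) := hhex₂ (mem_hexLabels_iff.2 (Or.inl rfl))
  have hb₂P : b₂ ∈ Pc (nb x t₂) := hhex₂ (mem_hexLabels_iff.2 (Or.inr (Or.inl rfl)))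
  -- the hexagon identities at `y₁`, `y₂`
  have hhexwv₁ : hexLabels (zlab Pc nb (nb x t₁) x) (zlab Pc nb (nb x t₁) (nb x t₂)) ⊆ Pc (nb x t₁) :=
    hexLabels_subset_of_symm (Pc (nb x t₁)) hPy₁ _ hw₁P _ hv₁P hDwv₁ hnw₁ hnv₁
  have hhexwv₂ : hexLabels (zlab Pc nb (nb x t₂) x) (zlab Pc nb (nb x t₂) (nb x t₁)) ⊆ Pc (nb x t₂) :=
    hexLabels_subset_of_symm (Pc (nb x t₂)) hPy₂ _ hw₂P _ hv₂P hDwv₂ hnw₂ hnv₂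
  have hdh₁ := dist_hexagon (Pc (nb x t₁)) hPy₁ _ hw₁P _ hv₁P hDwv₁ hhexwv₁
  have hdh₂ := dist_hexagon (Pc (nb x t₂)) hPy₂ _ hw₂P _ hv₂P hDwv₂ hhexwv₂
  -- expressions of the components
  have hb₁e : b₁ = zlab Pc nb (nb x t₁) (nb x t₂) - zlab Pc nb (nb x t₁) x := rfl
  have ha₁e : a₁ = -zlab Pc nb (nb x t₁) x := rfl
  have ha₂e : a₂ = zlab Pc nb (nb x t₂) (nb x t₁) - zlab Pc nb (nb x t₂) x := rfl
  have hb₂e : b₂ = -zlab Pc nb (nb x t₂) x := rfl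
  -- regimes at `y₁`, `y₂`
  have hregJ' : Pc (nb (nb x t₁) b₁) = fcc3Int ∨ Pc (nb x t₁) = hcpInt ∨
      (-zlab Pc nb (nb (nb x t₁) b₁) (nb x t₁) ∈ Pc (nb (nb x t₁) b₁) ∧
        -zlab Pc nb (nb (nb x t₁) b₁) (nb (nb x t₁) a₁) ∈ Pc (nb (nb x t₁) b₁)) := by
    rcases hA with hF | hH
    · exact Or.inl (hF _ (nb_mem hch hy₁S hb₁P).1)
    · exact Or.inr (Or.inl (htype₁ hH))
  have hregI' : Pc (nb (nb x t₂) a₂) = fcc3Int ∨ Pc (nb x t₂) = hcpInt ∨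
      (-zlab Pc nb (nb (nb x t₂) a₂) (nb x t₂) ∈ Pc (nb (nb x t₂) a₂) ∧
        -zlab Pc nb (nb (nb x t₂) a₂) (nb (nb x t₂) b₂) ∈ Pc (nb (nb x t₂) a₂)) := by
    rcases hA with hF | hH
    · exact Or.inl (hF _ (nb_mem hch hy₂S ha₂P).1)
    · exact Or.inr (Or.inl (htype₂ hH))
  -- the two second steps
  obtain ⟨hMS, hbyM, hw'P, hw'y, hv'P, hv'nb, -, -, hDw'v', -, -, hframeA, -, c₂', hc₂'U, hc₂'t,
    -, hbu', hμ'U, hUAeq, -⟩ := Jstep_spec hch hy₁S hframe₁ hregJ'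
  obtain ⟨hM₂S, hbyM₂, hw''P, hw''y, hv''P, hv''nb, -, -, hDw''v'', -, -, hframeB, -, c₁'', hc₁''U,
    hc₁''t, -, hbu'', hμ''U, hUBeq, -⟩ := Istep_spec hch hy₂S hframe₂ hregI'
  -- (a₀) the points agree: `M = nb y₁ b₁ = nb y₂ a₂ = M₂`
  have hbMy₂ : 0 < dist (nb (nb x t₁) b₁) (nb x t₂) ∧ dist (nb (nb x t₁) b₁) (nb x t₂) ≤ 28 / 25 := by
    have := (bond_nb_iff hch hy₁S hb₁P hv₁P).2 (by
      rw [hb₁e, show zlab Pc nb (nb x t₁) (nb x t₂) - zlab Pc nb (nb x t₁) x -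
        zlab Pc nb (nb x t₁) (nb x t₂) = -zlab Pc nb (nb x t₁) x by abel, sqNormInt_neg]
      exact sqNormInt_of_label hch hy₁S hw₁P)
    rwa [hv₁nb] at this
  have hθ := zlab_spec hch hy₂S hMS (bond_symm hbMy₂)
  have hbxy₁y₂ : 0 < dist (nb x t₁) (nb x t₂) ∧ dist (nb x t₁) (nb x t₂) ≤ 28 / 25 :=
    (bond_nb_iff hch hx ht₁ ht₂).2 h12
  have Dθv : sqNormInt (zlab Pc nb (nb x t₂) (nb (nb x t₁) b₁) - zlab Pc nb (nb x t₂) (nb x t₁)) = 18 := by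
    rw [transfer_nb_centre hch hy₁S hy₂S hbxy₁y₂ hb₁P (bond_symm hbMy₂)]
    exact sqNormInt_of_label hch hy₁S hb₁P
  have Dθw : sqNormInt (zlab Pc nb (nb x t₂) (nb (nb x t₁) b₁) - zlab Pc nb (nb x t₂) x) = 54 := by
    have hbx : 0 < dist (nb x t₂) (nb (nb x t₁) (zlab Pc nb (nb x t₁) x)) ∧
        dist (nb x t₂) (nb (nb x t₁) (zlab Pc nb (nb x t₁) x)) ≤ 28 / 25 := by
      rw [hw₁x]; exact bond_symm hbxy₂
    have htr := transfer_nb_nb hch hy₁S hy₂S hbxy₁y₂ hb₁P hw₁P (bond_symm hbMy₂) hbx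
    rw [hw₁x] at htr
    rw [htr, hb₁e, show zlab Pc nb (nb x t₁) (nb x t₂) - zlab Pc nb (nb x t₁) x -
      zlab Pc nb (nb x t₁) x = -(2 • zlab Pc nb (nb x t₁) x - zlab Pc nb (nb x t₁) (nb x t₂)) by
        rw [two_smul]; abel, sqNormInt_neg]
    exact hdh₁.2.2.2.1
  have hθeq : zlab Pc nb (nb x t₂) (nb (nb x t₁) b₁) = a₂ := by
    rw [ha₂e]
    exact label_third_vertex (Pc (nb x t₂)) hPy₂ _ hw₂P _ hv₂P _ hθ.1 hDwv₂ Dθv Dθw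
      (by rw [← ha₂e]; exact ha₂P)
  have hMeq : nb (nb x t₂) a₂ = nb (nb x t₁) b₁ := by rw [← hθeq]; exact hθ.2
  rw [hMeq] at hw''P hw''y hv''P hv''nb hframeB hbu'' hUBeq hM₂S hbyM₂ hDw''v'' hμ''U
  set M := nb (nb x t₁) b₁ with hM_def
  have hPM := pattern_cases hch hMS
  -- (b₀) the labels at `M`: `α` of `y₁`, `β` of `y₂`, `γ` of `IIx`, `δ` of `JJx`
  set α := zlab Pc nb M (nb x t₁) with hα_def
  set β := zlab Pc nb M (nb x t₂) with hβ_def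
  set γ := zlab Pc nb M (nb (nb x t₁) a₁) with hγ_def
  set δ := zlab Pc nb M (nb (nb x t₂) b₂) with hδ_def
  obtain ⟨h12A, hhexA, -, hoffA, -⟩ := id hframeA
  obtain ⟨h12B, hhexB, -, hoffB, -⟩ := id hframeB
  have hnα : -α ∈ Pc M := hhexA (mem_hexLabels_iff.2 (Or.inr (Or.inl rfl)))
  have hnβ : -β ∈ Pc M := by
    have h := hhexB (mem_hexLabels_iff.2 (Or.inl rfl))
    change -zlab Pc nb (nb (nb x t₂) a₂) (nb x t₂) ∈ Pc M at h
    rwa [hMeq] at h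
  have Dαβ : sqNormInt (α - β) = 18 := by
    have h := (bond_nb_iff hch hMS hw'P hw''P).1 (by rw [hw'y, hw''y]; exact hbxy₁y₂)
    exact h
  have hαβ : α - β ∈ Pc M :=
    sub_mem_of_onesided (Pc M) hPM β hw''P α hw'P (by rw [sqNormInt_sub_comm]; exact Dαβ)
      (Or.inl ⟨hnβ, hnα⟩)
  have hβα : β - α ∈ Pc M :=
    sub_mem_of_onesided (Pc M) hPM α hw'P β hw''P Dαβ (Or.inl ⟨hnα, hnβ⟩)
  -- `γ = α − β`
  have hbMII : 0 < dist M (nb (nb x t₁) a₁) ∧ dist M (nb (nb x t₁) a₁) ≤ 28 / 25 := by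
    rw [← hv'nb]; exact (nb_mem hch hMS hv'P).2
  have Dγβ : sqNormInt (γ - β) = 54 := by
    have hbMy₂' : 0 < dist M (nb (nb x t₁) (zlab Pc nb (nb x t₁) (nb x t₂))) ∧
        dist M (nb (nb x t₁) (zlab Pc nb (nb x t₁) (nb x t₂))) ≤ 28 / 25 := by
      rw [hv₁nb]; exact hbMy₂
    have htr := transfer_nb_nb hch hy₁S hMS hbyM ha₁P hv₁P hbMII hbMy₂'
    rw [hv₁nb] at htr
    rw [hγ_def, hβ_def, htr, ha₁e, show -zlab Pc nb (nb x t₁) x - zlab Pc nb (nb x t₁) (nb x t₂) =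
      -(zlab Pc nb (nb x t₁) x + zlab Pc nb (nb x t₁) (nb x t₂)) by abel, sqNormInt_neg]
    exact hdh₁.2.2.1
  have hγeq : γ = α - β :=
    label_third_vertex (Pc M) hPM β hw''P α hw'P γ hv'P (by rw [sqNormInt_sub_comm]; exact Dαβ)
      (by rw [sqNormInt_sub_comm]; exact hDw'v') Dγβ hαβ
  -- `δ = β − α`
  have hbMJJ : 0 < dist M (nb (nb x t₂) b₂) ∧ dist M (nb (nb x t₂) b₂) ≤ 28 / 25 := by
    rw [← hv''nb]; exact (nb_mem hch hMS hv''P).2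
  have Dδα : sqNormInt (δ - α) = 54 := by
    have hbMy₁' : 0 < dist M (nb (nb x t₂) (zlab Pc nb (nb x t₂) (nb x t₁))) ∧
        dist M (nb (nb x t₂) (zlab Pc nb (nb x t₂) (nb x t₁))) ≤ 28 / 25 := by
      rw [hv₂nb]; exact bond_symm hbyM
    have htr := transfer_nb_nb hch hy₂S hMS hbyM₂ hb₂P hv₂P hbMJJ hbMy₁'
    rw [hv₂nb] at htr
    rw [hδ_def, hα_def, htr, hb₂e, show -zlab Pc nb (nb x t₂) x - zlab Pc nb (nb x t₂) (nb x t₁) =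
      -(zlab Pc nb (nb x t₂) x + zlab Pc nb (nb x t₂) (nb x t₁)) by abel, sqNormInt_neg]
    exact hdh₂.2.2.1
  have hδeq : δ = β - α :=
    label_third_vertex (Pc M) hPM α hw'P β hw''P δ hv''P Dαβ
      (by rw [sqNormInt_sub_comm]; exact hDw''v'') Dδα hβα
  -- the direction components agree
  have e₁ : (Istep Pc nb ⟨nb x t₂, a₂, b₂, U₂⟩).t₁ = (Jstep Pc nb ⟨nb x t₁, a₁, b₁, U₁⟩).t₁ := by
    show -zlab Pc nb (nb (nb x t₂) a₂) (nb x t₂) = γ - α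
    rw [hMeq, hγeq]; abel
  have e₂ : (Istep Pc nb ⟨nb x t₂, a₂, b₂, U₂⟩).t₂ = (Jstep Pc nb ⟨nb x t₁, a₁, b₁, U₁⟩).t₂ := by
    show zlab Pc nb (nb (nb x t₂) a₂) (nb (nb x t₂) b₂) - zlab Pc nb (nb (nb x t₂) a₂) (nb x t₂) = -α
    rw [hMeq]
    show δ - β = -α
    rw [hδeq]; abel
  have ept : (Istep Pc nb ⟨nb x t₂, a₂, b₂, U₂⟩).pt = (Jstep Pc nb ⟨nb x t₁, a₁, b₁, U₁⟩).pt := hMeq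
  -- (c₀) the caps: the two transported upper references are the `τ₁`- and `τ₂`-neighbours of `V g`
  have hpar₁' : frameParity a₁ b₁ U₁ = 1 := hpar₁.trans hpar
  have hpar₂' : frameParity a₂ b₂ U₂ = 1 := hpar₂.trans hpar
  obtain ⟨hc₁'U, hc₁'P, hc₁'off, hc₁1, hc₁2, hE₁⟩ := even_form_of_parity hPy₁ hframe₁ hpar₁'
  obtain ⟨hc₂''U, hc₂''P, hc₂''off, hc₂1, hc₂2, hE₂⟩ := even_form_of_parity hPy₂ hframe₂ hpar₂'
  set c₁' := apexOf a₁ b₁ U₁ with hc₁'_def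
  set c₂'' := apexOf a₂ b₂ U₂ with hc₂''_def
  have hc₂' : c₂' = c₁' := by
    obtain ⟨-, -, -, -, -, -, -, -, -, -, -, -, -, c₃, -, -, hfilt₃, -, -, -, -⟩ :=
      Jstep_spec hch hy₁S hframe₁ hregJ'
    have h1 := (filter_evenCap (Pc (nb x t₁)) hPy₁ a₁ ha₁P b₁ hb₁P c₁' hc₁'P h12₁ hhex₁ hc₁'off hc₁1 hc₁2).2.1
    rw [← hE₁, hfilt₃] at h1
    have hmem : c₂' ∈ U₁.filter (fun e => sqNormInt (e - b₁) = 18) := Finset.mem_filter.2 ⟨hc₂'U, hc₂'t⟩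
    rw [hfilt₃, Finset.mem_singleton] at hmem
    rw [hmem]; exact Finset.singleton_injective h1
  have hc₁'' : c₁'' = c₂'' := by
    obtain ⟨-, -, -, -, -, -, -, -, -, -, -, -, -, c₃, -, -, hfilt₃, -, -, -, -⟩ :=
      Istep_spec hch hy₂S hframe₂ hregI'
    have h1 := (filter_evenCap (Pc (nb x t₂)) hPy₂ a₂ ha₂P b₂ hb₂P c₂'' hc₂''P h12₂ hhex₂ hc₂''off hc₂1 hc₂2).1
    rw [← hE₂, hfilt₃] at h1
    have hmem : c₁'' ∈ U₂.filter (fun e => sqNormInt (e - a₂) = 18) := Finset.mem_filter.2 ⟨hc₁''U, hc₁''t⟩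
    rw [hfilt₃, Finset.mem_singleton] at hmem
    rw [hmem]; exact Finset.singleton_injective h1
  rw [hc₂'] at hbu' hμ'U hUAeq
  rw [hc₁''] at hbu'' hμ''U hUBeq
  -- the two reference sites are `nb u τ₁` and `nb u τ₂`
  have hp' : nb (nb x t₁) c₁' = nb u τ₁ := hptI
  have hp : nb (nb x t₂) c₂'' = nb u τ₂ := hptJ
  have hbpp : 0 < dist (nb (nb x t₁) c₁') (nb (nb x t₂) c₂'') ∧
      dist (nb (nb x t₁) c₁') (nb (nb x t₂) c₂'') ≤ 28 / 25 := by
    rw [hp', hp]; exact (bond_nb_iff hch huS hτ₁P hτ₂P).2 hframeV.1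
  have hμ' := zlab_spec hch hMS (nb_mem hch hy₁S hc₁'P).1 hbu'
  have hμ'' := zlab_spec hch hMS (nb_mem hch hy₂S hc₂''P).1 hbu''
  have Dμμ : sqNormInt (zlab Pc nb M (nb (nb x t₂) c₂'') - zlab Pc nb M (nb (nb x t₁) c₁')) = 18 := by
    refine (bond_nb_iff hch hMS hμ''.1 hμ'.1).1 ?_
    rw [hμ'.2, hμ''.2]; exact bond_symm hbpp
  have hμ''off : zlab Pc nb M (nb (nb x t₂) c₂'') ∉ hexLabels (Jstep Pc nb ⟨nb x t₁, a₁, b₁, U₁⟩).t₁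
      (Jstep Pc nb ⟨nb x t₁, a₁, b₁, U₁⟩).t₂ := by
    rw [← e₁, ← e₂]; exact hoffB _ hμ''U
  have hμ''UA : zlab Pc nb M (nb (nb x t₂) c₂'') ∈ (Jstep Pc nb ⟨nb x t₁, a₁, b₁, U₁⟩).U := by
    rw [hUAeq]
    simp only [capWithAny, Finset.mem_filter, Finset.mem_singleton]
    exact ⟨hμ''.1, hμ''off, _, rfl, Or.inr Dμμ⟩
  have hU : (Istep Pc nb ⟨nb x t₂, a₂, b₂, U₂⟩).U = (Jstep Pc nb ⟨nb x t₁, a₁, b₁, U₁⟩).U := by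
    rw [hUBeq, e₁, e₂]
    exact capWithAny_of_mem_cap hch hMS hframeA hμ''UA
  exact ZFrame.ext' ept e₁ e₂ hU

end Summit.AtomisticToContinuum.Crystallization.Theorems.PalmUnimodularRigidityShellsToBarlowChart.Clean

end
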